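import Mathlib.Analysis.Distribution.AEEqOfIntegralContDiff
import Literature.Analysis.FunctionSpaces.TorusTestFunction
import Literature.Analysis.FunctionSpaces.TorusPeriodization
import HarnessLib

/-!
# The du Bois-Reymond lemma on the flat torus (proofs)

Topic: Analysis/FunctionSpaces, proofs for `Literature.Analysis.FunctionSpaces.TorusTestFunction`.
That file records two du Bois-Reymond–type uniqueness statements as named facts (Evans, *PDE*,
§5.2.1, Lemma "uniqueness of weak derivatives", whose proof is the fundamental lemma of the
calculus of variations): `Torus.HasWeakPartialDeriv.unique F` (integrable weak partial
derivatives on `T^d` are unique a.e.) and `Torus.Distribution.ofFun_injective_on_continuous F`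
(`f ↦ T_f` is injective on continuous functions). Both are discharged here:

* `Torus.ae_eq_zero_of_forall_integral_smul_eq_zero` — **the fundamental lemma of the calculus
  of variations on `T^d`**, `L¹` and Banach-valued form: if `h ∈ L¹(T^d; F)` and
  `∫ φ • h = 0` for every smooth real `φ` on `T^d`, then `h = 0` a.e. Proof by lifting to
  `ℝ^d`: the lift `h ∘ proj` is locally integrable (`Torus.locallyIntegrable_lift`), and for a
  compactly supported smooth `g` on `ℝ^d` the unfolding identity
  `∫_{ℝ^d} g • (h ∘ proj) = ∫_{T^d} (periodize g) • h` (`Torus.integral_eq_integral_perSum_repr`,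
  `Torus.perSum_smul_lift`) and smoothness of the periodisation (`Torus.isSmooth_periodize`)
  reduce to Mathlib's `ae_eq_zero_of_integral_contDiff_smul_eq_zero` on `ℝ^d`; the conclusion
  descends along the quasi-measure-preserving section `repr` (`Torus.quasiMeasurePreserving_repr`).
* `Torus.HasWeakPartialDeriv.unique_holds`, `Torus.Distribution.ofFun_injective_on_continuous_holds`.

## References

* L. C. Evans, *Partial Differential Equations*, 2nd ed. (AMS 2010), §5.2.1, Lemma (uniqueness
  of weak derivatives). [Evans2010]
* L. Grafakos, *Classical Fourier Analysis*, 3rd ed. (2014), §3.1.1 (periodisation). [Grafakos2014]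
* Mathlib: `ae_eq_zero_of_integral_contDiff_smul_eq_zero`
  (`Mathlib/Analysis/Distribution/AEEqOfIntegralContDiff`).
-/

noncomputable section

open MeasureTheory TopologicalSpace Set Function Filter Topology Metric
open scoped ContDiff

namespace Literature.Analysis.FunctionSpaces.Torus

variable {d : Type*} [Fintype d]
variable {F : Type*} [NormedAddCommGroup F] [NormedSpace ℝ F]

/-! ## Periodisation against a periodic factor -/

/-- The lattice translates of a boundedly supported function at a fixed point form a finitely
supported, hence summable, family. [folklore] -/
theorem summable_apply_add_latticeVec [DecidableEq d] {G : Type*} [AddCommGroup G]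
    [TopologicalSpace G] {g : EuclideanSpace ℝ d → G} {R : ℝ} (hg : support g ⊆ closedBall 0 R)
    (y : EuclideanSpace ℝ d) : Summable fun k : d → ℤ => g (y + latticeVec k) := by
  obtain ⟨n, hn⟩ := exists_nat_ge (R + ‖y‖)
  exact summable_of_ne_finset_zero (s := latticeWindow d n) fun k hk =>
    apply_add_latticeVec_eq_zero hg le_rfl hn hk

/-- **Periodisation against a periodic factor**: for `g` with bounded support on `ℝ^d` and any
`h` on `T^d`, `∑ₖ g(y + k) • h(proj (y + k)) = (∑ₖ g(y + k)) • h(proj y)`. [folklore] -/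
theorem perSum_smul_lift [DecidableEq d] {g : EuclideanSpace ℝ d → ℝ} {R : ℝ}
    (hg : support g ⊆ closedBall 0 R) (h : UnitAddTorus d → F) (y : EuclideanSpace ℝ d) :
    perSum (fun z => g z • lift h z) y = perSum g y • lift h y := by
  simp only [perSum_apply, lift_apply, proj_add_latticeVec]
  exact (summable_apply_add_latticeVec hg y).tsum_smul_const _

/-! ## The fundamental lemma of the calculus of variations on `T^d` -/

variable [CompleteSpace F]

/-- **Fundamental lemma of the calculus of variations on the flat torus** (`L¹`, Banach-valued):
an integrable `h : T^d → F` with `∫ φ • h = 0` for every smooth real `φ` vanishes a.e.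
(Evans 2010, §5.2.1, proof of the uniqueness lemma; here obtained from the `ℝ^d` statement,
Mathlib's `ae_eq_zero_of_integral_contDiff_smul_eq_zero`, by unfolding
`∫_{ℝ^d} g • (h ∘ proj) = ∫_{T^d} (periodize g) • h`, Grafakos 2014, §3.1.1). [cite: Evans2010, §5.2.1 Lemma (Uniqueness of weak derivatives)] -/
theorem ae_eq_zero_of_forall_integral_smul_eq_zero {h : UnitAddTorus d → F}
    (hh : Integrable h volume)
    (H : ∀ φ : UnitAddTorus d → ℝ, IsSmooth φ → ∫ x, φ x • h x = 0) : h =ᵐ[volume] 0 := by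
  classical
  have hL : LocallyIntegrable (lift h) volume := locallyIntegrable_lift hh
  have hzero : ∀ᵐ y ∂(volume : Measure (EuclideanSpace ℝ d)), lift h y = 0 := by
    refine ae_eq_zero_of_integral_contDiff_smul_eq_zero hL fun g hg hgc => ?_
    obtain ⟨R, hR⟩ := hgc.isCompact.isBounded.subset_closedBall 0
    have hgs : support g ⊆ closedBall 0 R := (subset_tsupport _).trans hR
    have hGi : Integrable (fun y => g y • lift h y) volume :=
      hL.integrable_smul_left_of_hasCompactSupport hg.continuous hgc
    have hGs : support (fun y => g y • lift h y) ⊆ closedBall 0 R :=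
      (support_smul_subset_left _ _).trans hgs
    rw [integral_eq_integral_perSum_repr hGi hGs]
    have hpt : ∀ x : UnitAddTorus d,
        perSum (fun y => g y • lift h y) (repr x) = periodize g x • h x := fun x => by
      rw [perSum_smul_lift hgs h, periodize_apply, lift_apply, proj_repr]
    simp_rw [hpt]
    exact H _ (isSmooth_periodize hg hR)
  filter_upwards [quasiMeasurePreserving_repr.ae hzero] with x hx
  simpa [lift_apply, proj_repr] using hx

/-! ## The discharges -/

/-- **Discharge of `Torus.HasWeakPartialDeriv.unique`** (Evans 2010, §5.2.1, Lemma: weak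
derivatives are unique a.e.): subtracting the two defining identities gives `∫ φ • (g − g') = 0`
for all smooth `φ`, and the fundamental lemma (`ae_eq_zero_of_forall_integral_smul_eq_zero`)
concludes. [cite: Evans2010, §5.2.1 Lemma (Uniqueness of weak derivatives)] -/
theorem HasWeakPartialDeriv.unique_holds [DecidableEq d] (F : Type*) [NormedAddCommGroup F]
    [NormedSpace ℝ F] [CompleteSpace F] : HasWeakPartialDeriv.unique (d := d) F := by
  intro i f g g' hg hg' h h'
  have hzero : ∀ φ : UnitAddTorus d → ℝ, IsSmooth φ → ∫ x, φ x • (g x - g' x) = 0 := by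
    intro φ hφ
    have e : ∫ x, φ x • g x = ∫ x, φ x • g' x := neg_inj.1 ((h φ hφ).symm.trans (h' φ hφ))
    simp_rw [smul_sub]
    rw [integral_sub (hφ.integrable_smul hg) (hφ.integrable_smul hg'), e, sub_self]
  filter_upwards [ae_eq_zero_of_forall_integral_smul_eq_zero (hg.sub hg') hzero] with x hx
  exact sub_eq_zero.1 hx

/-- **Discharge of `Torus.Distribution.ofFun_injective_on_continuous`** (Evans 2010, §5.2.1):
for continuous `f, g` with `T_f = T_g`, `∫ φ • (f − g) = 0` for all smooth `φ`
(`Distribution.ofFun_apply`), so `f = g` a.e. by the fundamental lemma, hence everywhere by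
continuity (Lebesgue measure on `T^d` charges open sets). [cite: Evans2010, §5.2.1 Lemma (Uniqueness of weak derivatives)] -/
theorem Distribution.ofFun_injective_on_continuous_holds (F : Type*) [NormedAddCommGroup F]
    [NormedSpace ℝ F] [CompleteSpace F] :
    Distribution.ofFun_injective_on_continuous (d := d) F := by
  intro f g hf hg hfg
  have hfi : Integrable f volume := hf.integrable_unitAddTorus
  have hgi : Integrable g volume := hg.integrable_unitAddTorus
  have hzero : ∀ φ : UnitAddTorus d → ℝ, IsSmooth φ → ∫ x, φ x • (f x - g x) = 0 := by
    intro φ hφ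
    have e := LinearMap.congr_fun hfg ⟨φ, hφ⟩
    rw [Distribution.ofFun_apply hfi, Distribution.ofFun_apply hgi] at e
    simp_rw [smul_sub]
    rw [integral_sub (hφ.integrable_smul hfi) (hφ.integrable_smul hgi), sub_eq_zero]
    exact e
  have hae : (fun x => f x - g x) =ᵐ[volume] 0 :=
    ae_eq_zero_of_forall_integral_smul_eq_zero (hfi.sub hgi) hzero
  have heq : (fun x => f x - g x) = 0 :=
    (Continuous.ae_eq_iff_eq volume (hf.sub hg) continuous_const).1 hae
  funext x
  exact sub_eq_zero.1 (congr_fun heq x)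

end Literature.Analysis.FunctionSpaces.Torus
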